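import Summits.CriticalPhenomena.Ising3DConformalLimit.Theorems.InverseSquareTelemetryPositiveSolutionAsymptoticsAssemblyStep
import Summits.CriticalPhenomena.Ising3DConformalLimit.Theorems.InverseSquareTelemetryPositiveSolutionAsymptoticsLocalComparison
import Summits.CriticalPhenomena.Ising3DConformalLimit.Theorems.InverseSquareTelemetryPositiveSolutionAsymptoticsAnnulusChain
import Summits.CriticalPhenomena.Ising3DConformalLimit.Theorems.InverseSquareTelemetryPositiveSolutionAsymptoticsShellMonotone
import HarnessLib

/-!
# Crux `PositiveSolutionAsymptotics` (stmt-CriticalPhenomena-4496), line `registered`: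
# the lead's assembly `blowDown_assembly` (T1 → T2 → T3 → T4 → S2) and the registered stub
# `stub_blowDownOfHarnack` (T2 → S2)

THEOREM-ONLY file (`--supports stmt-CriticalPhenomena-4496`).

The blow-down constant of the lattice Agmon–Murata asymptotics on `ℤ³` without a continuum limit:
shell extrema of `q = u |x|₂^{α₊}` (T1 `stub_shellMonotone`), local `(Δ - V)`-harmonic comparison
functions `H ≈ |x|₂^{-α₊}` (T3 `stub_localComparison`), the elliptic Harnack inequality for uniformly
elliptic conductances on `ℤ³` (T2 `stub_conductanceHarnack`, Barlow 2017 Thm 7.19) applied to the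
Doob transform `u/H` (`latticeLaplacianZd_doob_transform`), and chains in lattice annuli
(T4 `stub_annulusChain`) give oscillation decay of `q`, hence `q → c`, which is S2
`stub_blowDownConstant` of the skeleton `Cruxes/PositiveSolutionAsymptotics/Lines/birth.lean`.
-/

noncomputable section

namespace Summit.CriticalPhenomena.Ising3DConformalLimit.Theorems.PositiveSolutionAsymptotics

open Literature.Probability.LatticeModels Finset Set Filter Topology
open Summit.CriticalPhenomena.Ising3DConformalLimit.Theorems.PositiveSolutionAsymptotics.Assembly

/-- **The lead's assembly (full implication T1 → T2 → T3 → T4 → S2).**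
Shell maxima and minima of `q = u|x|₂^{α₊}` are related to the exterior suprema `Qsup(S)` and infima
`Qinf(S)` by T1; `Qsup` is antitone and `Qinf` monotone, so both converge (`Lp`, `Lm`). At a large
scale `S' = r²` a chain of `N` steps `≤ r/64` (T4) joins a shell maximiser `x₁` to a shell minimiser
`x₂`; along it, the Doob transform of `Δ - V` by the local harmonic comparison function `H` of T3 on the
lattice ball of radius `r/8` is harmonic for the conductances `H(x)H(y)`, which are `4·900^{α₊}`-elliptic
after scaling by `r^{2α₊}`, and the elliptic Harnack inequality T2 propagates near-maximality
(`propagate`, `chain_bound`): `Qinf(S') ≥ (1-η₁)(Q - C^N((Q - Qsup(S')/(1+η₁)) + 3Nη₃Q))`,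
`Q = Qsup(S'/100)`. Letting `S' → ∞` gives `Lm ≥ Lp`, hence `q → Lp ∈ [m, M]` cofinitely, and every
large scale is a good scale. -/
theorem blowDown_assembly :
    (∀ κ ε C : ℝ, 0 ≤ κ → 0 < ε → ∀ (u V : Literature.Probability.LatticeModels.Site 3 → ℝ) (R : ℝ), (∀ x : Literature.Probability.LatticeModels.Site 3, R ≤ Real.sqrt (∑ i, ((x i : ℝ)) ^ 2) → 0 < u x) → (∀ x : Literature.Probability.LatticeModels.Site 3, R ≤ Real.sqrt (∑ i, ((x i : ℝ)) ^ 2) → (∑ i : Fin 3, (u (x + Pi.single i 1) + u (x - Pi.single i 1))) - 6 * u x = V x * u x) → (∀ x : Literature.Probability.LatticeModels.Site 3, R ≤ Real.sqrt (∑ i, ((x i : ℝ)) ^ 2) → |(∑ i, ((x i : ℝ)) ^ 2) * V x - κ| ≤ C * Real.sqrt (∑ i, ((x i : ℝ)) ^ 2) ^ (-ε)) → Filter.Tendsto u Filter.cofinite (nhds 0) → ∃ (S₀ : ℝ) (η : ℝ → ℝ), Filter.Tendsto η Filter.atTop (nhds 0) ∧ (∀ S : ℝ, S₀ ≤ S →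 0 ≤ η S ∧ η S ≤ 1 / 2) ∧ ∀ S K : ℝ, S₀ ≤ S → 0 ≤ K → ((∀ y : Literature.Probability.LatticeModels.Site 3, S / 4 ≤ (∑ i, ((y i : ℝ)) ^ 2) → (∑ i, ((y i : ℝ)) ^ 2) < S → u y * Real.sqrt (∑ i, ((y i : ℝ)) ^ 2) ^ ((1 + Real.sqrt (1 + 4 * κ)) / 2) ≤ K) → ∀ x : Literature.Probability.LatticeModels.Site 3, S ≤ (∑ i, ((x i : ℝ)) ^ 2) → u x * Real.sqrt (∑ i, ((x i : ℝ)) ^ 2) ^ ((1 + Real.sqrt (1 + 4 * κ)) / 2) ≤ (1 + η S) * K) ∧ ((∀ y : Literature.Probability.LatticeModels.Site 3, S / 4 ≤ (∑ i, ((y i : ℝ)) ^ 2) → (∑ i, ((y i : ℝ)) ^ 2) < S → K ≤ u y * Real.sqrt (∑ i, ((y i : ℝ)) ^ 2) ^ ((1 + Real.sqrt (1 + 4 * κ)) / 2)) → ∀ x : Literature.Probability.LatticeModels.Site 3, S ≤ (∑ i, ((x i : ℝ)) ^ 2) → (1 - η S) * K ≤ u x * Real.sqrt (∑ i, ((x i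 : ℝ)) ^ 2) ^ ((1 + Real.sqrt (1 + 4 * κ)) / 2))) →
    (∀ Λ : ℝ, 1 ≤ Λ → ∃ C : ℝ, 1 ≤ C ∧ ∀ (μ : Literature.Probability.LatticeModels.Site 3 → Literature.Probability.LatticeModels.Site 3 → ℝ) (h : Literature.Probability.LatticeModels.Site 3 → ℝ) (x₀ : Literature.Probability.LatticeModels.Site 3) (R : ℕ), 1 ≤ R → (∀ x : Literature.Probability.LatticeModels.Site 3, ∀ i : Fin 3, μ x (x + Pi.single i 1) = μ (x + Pi.single i 1) x) → (∀ x : Literature.Probability.LatticeModels.Site 3, ∀ i : Fin 3, Λ⁻¹ ≤ μ x (x + Pi.single i 1) ∧ μ x (x + Pi.single i 1) ≤ Λ) → (∀ x : Literature.Probability.LatticeModels.Site 3, 0 ≤ h x) → (∀ x : Literature.Probability.LatticeModels.Site 3, (∑ i, |x i - x₀ i|) ≤ 2 * (R : ℤ) → (∑ i : Fin 3, (μ x (x + Pi.single i 1) * (h (x + Pi.single i 1) - h x) + μ x (x - Pi.single i 1) * (h (x - Pi.single i 1) - h x))) = 0) → ∀ x y : Literature.Probability.LatticeModels.Site 3,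 (∑ i, |x i - x₀ i|) ≤ (R : ℤ) → (∑ i, |y i - x₀ i|) ≤ (R : ℤ) → h x ≤ C * h y) →
    (∀ κ ε C : ℝ, 0 ≤ κ → 0 < ε → ∀ (V : Literature.Probability.LatticeModels.Site 3 → ℝ) (R : ℝ), (∀ x : Literature.Probability.LatticeModels.Site 3, R ≤ Real.sqrt (∑ i, ((x i : ℝ)) ^ 2) → |(∑ i, ((x i : ℝ)) ^ 2) * V x - κ| ≤ C * Real.sqrt (∑ i, ((x i : ℝ)) ^ 2) ^ (-ε)) → ∃ (S₁ : ℝ) (η : ℝ → ℝ), Filter.Tendsto η Filter.atTop (nhds 0) ∧ (∀ S : ℝ, S₁ ≤ S → 0 ≤ η S ∧ η S ≤ 1 / 2) ∧ ∀ S : ℝ, S₁ ≤ S → ∀ D : Set (Literature.Probability.LatticeModels.Site 3), D.Finite → (∀ x ∈ D, S ≤ (∑ i, ((x i : ℝ)) ^ 2)) → ∃ H : Literature.Probability.LatticeModels.Site 3 → ℝ, (∀ x ∈ D, (∑ i : Fin 3, (H (x + Pi.single i 1) + H (x - Pi.single i 1))) - 6 * H x = V x * H x) ∧ (∀ y : Literature.Probability.LatticeModels.Site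 3, y ∉ D → H y = Real.sqrt (∑ i, ((y i : ℝ)) ^ 2) ^ (-((1 + Real.sqrt (1 + 4 * κ)) / 2))) ∧ (∀ x ∈ D, (1 - η S) * Real.sqrt (∑ i, ((x i : ℝ)) ^ 2) ^ (-((1 + Real.sqrt (1 + 4 * κ)) / 2)) ≤ H x ∧ H x ≤ (1 + η S) * Real.sqrt (∑ i, ((x i : ℝ)) ^ 2) ^ (-((1 + Real.sqrt (1 + 4 * κ)) / 2)))) →
    (∀ θ : ℝ, 0 < θ → ∃ (N : ℕ) (r₀ : ℝ), ∀ r : ℝ, r₀ ≤ r → ∀ x y : Literature.Probability.LatticeModels.Site 3, r / 2 ≤ Real.sqrt (∑ i, ((x i : ℝ)) ^ 2) → Real.sqrt (∑ i, ((x i : ℝ)) ^ 2) ≤ r → r / 2 ≤ Real.sqrt (∑ i, ((y i : ℝ)) ^ 2) → Real.sqrt (∑ i, ((y i : ℝ)) ^ 2) ≤ r → ∃ z : ℕ → Literature.Probability.LatticeModels.Site 3, z 0 = x ∧ z N = y ∧ (∀ j : ℕ, j ≤ N → r / 4 ≤ Real.sqrt (∑ i, (((z j) i : ℝ)) ^ 2)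 ∧ Real.sqrt (∑ i, (((z j) i : ℝ)) ^ 2) ≤ 2 * r) ∧ (∀ j : ℕ, j < N → Real.sqrt (∑ i, (((z (j + 1)) i : ℝ) - ((z j) i : ℝ)) ^ 2) ≤ θ * r)) →
    ∀ κ ε C : ℝ, 0 ≤ κ → 0 < ε → ∀ (u V : Literature.Probability.LatticeModels.Site 3 → ℝ) (R : ℝ), (∀ x : Literature.Probability.LatticeModels.Site 3, R ≤ Real.sqrt (∑ i, ((x i : ℝ)) ^ 2) → 0 < u x) → (∀ x : Literature.Probability.LatticeModels.Site 3, R ≤ Real.sqrt (∑ i, ((x i : ℝ)) ^ 2) → (∑ i : Fin 3, (u (x + Pi.single i 1) + u (x - Pi.single i 1))) - 6 * u x = V x * u x) → (∀ x : Literature.Probability.LatticeModels.Site 3, R ≤ Real.sqrt (∑ i, ((x i : ℝ)) ^ 2) → |(∑ i, ((x i : ℝ)) ^ 2) * V x - κ| ≤ C * Real.sqrt (∑ i, ((x i : ℝ)) ^ 2) ^ (-ε)) → Filter.Tendsto u Filter.cofinite (nhds 0) → ∀ m M : ℝ, 0 < m → (∀ᶠ x : Literature.Probability.LatticeModels.Site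 3 in Filter.cofinite, m ≤ u x * Real.sqrt (∑ i, ((x i : ℝ)) ^ 2) ^ ((1 + Real.sqrt (1 + 4 * κ)) / 2) ∧ u x * Real.sqrt (∑ i, ((x i : ℝ)) ^ 2) ^ ((1 + Real.sqrt (1 + 4 * κ)) / 2) ≤ M) → ∃ c : ℝ, m ≤ c ∧ c ≤ M ∧ ∀ δ : ℝ, 0 < δ → ∀ ρ₀ : ℝ, ∃ ρ : ℝ, ρ₀ ≤ ρ ∧ ∀ x : Literature.Probability.LatticeModels.Site 3, ρ ≤ Real.sqrt (∑ i, ((x i : ℝ)) ^ 2) → Real.sqrt (∑ i, ((x i : ℝ)) ^ 2) ≤ 2 * ρ → |u x * Real.sqrt (∑ i, ((x i : ℝ)) ^ 2) ^ ((1 + Real.sqrt (1 + 4 * κ)) / 2) - c| ≤ δ := by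
  intro hT1 hT2 hT3 hT4 κ ε C hκ hε u V R hpos heq hV h0 m M hm hbd
  classical
  -- instantiate the analytic stubs
  obtain ⟨S₀, η₁, hη₁t, hη₁b, hT1'⟩ := hT1 κ ε C hκ hε u V R hpos heq hV h0
  obtain ⟨S₁, η₃, hη₃t, hη₃b, hT3'⟩ := hT3 κ ε C hκ hε V R hV
  obtain ⟨N, r₀, hT4'⟩ := hT4 (1 / 64) (by norm_num)
  clear hT1 hT3 hT4
  -- the exponent
  set α : ℝ := (1 + Real.sqrt (1 + 4 * κ)) / 2 with hα
  have hα1 : 1 ≤ α := by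
    have : (1 : ℝ) ≤ Real.sqrt (1 + 4 * κ) := by
      rw [Real.le_sqrt (by norm_num) (by linarith)]; linarith
    rw [hα]; linarith
  have hα0 : 0 ≤ α := by linarith
  -- the Harnack constant
  have hΛ : (1 : ℝ) ≤ 4 * (900 : ℝ) ^ α := by
    have := Real.one_le_rpow (by norm_num : (1 : ℝ) ≤ 900) hα0
    linarith
  obtain ⟨Cst, hCst, hHar⟩ := hT2 (4 * (900 : ℝ) ^ α) hΛ
  clear hT2
  -- the Euclidean norm and `q`
  obtain ⟨nrm, hnrm⟩ : ∃ nrm : Literature.Probability.LatticeModels.Site 3 → ℝ,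
      ∀ x, nrm x = Real.sqrt (∑ i, ((x i : ℤ) : ℝ) ^ 2) := ⟨_, fun _ => rfl⟩
  simp only [← hnrm] at hT1' hT3' hT4' hpos heq hV hbd ⊢
  obtain ⟨q, hq⟩ : ∃ q : Literature.Probability.LatticeModels.Site 3 → ℝ, ∀ x, q x = u x * nrm x ^ α :=
    ⟨_, fun _ => rfl⟩
  simp only [← hq] at hT1' hbd ⊢
  have hsum_nn : ∀ x : Literature.Probability.LatticeModels.Site 3, (0 : ℝ) ≤ ∑ i, ((x i : ℤ) : ℝ) ^ 2 :=
    fun x => by positivity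
  have hnrm_nn : ∀ x, 0 ≤ nrm x := fun x => by rw [hnrm]; exact Real.sqrt_nonneg _
  have hnrm_sq : ∀ x, nrm x ^ 2 = ∑ i, ((x i : ℤ) : ℝ) ^ 2 := fun x => by
    rw [hnrm, Real.sq_sqrt (hsum_nn x)]
  have hnrm_le : ∀ (x : Literature.Probability.LatticeModels.Site 3) (t : ℝ), 0 ≤ t →
      (t ≤ nrm x ↔ t ^ 2 ≤ ∑ i, ((x i : ℤ) : ℝ) ^ 2) := fun x t ht => by
    rw [hnrm]; exact Real.le_sqrt ht (hsum_nn x)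
  have hnrm_ge : ∀ (x : Literature.Probability.LatticeModels.Site 3) (t : ℝ), 0 ≤ t →
      (nrm x ≤ t ↔ ∑ i, ((x i : ℤ) : ℝ) ^ 2 ≤ t ^ 2) := fun x t ht => by
    rw [hnrm]; exact Real.sqrt_le_left ht
  -- positivity of `q` far out
  have hqpos : ∀ x, R ≤ nrm x → 0 < nrm x → 0 < q x := fun x hx hn => by
    rw [hq]; exact mul_pos (hpos x hx) (Real.rpow_pos_of_pos hn _)
  -- global bounds of `q` and the level beyond which `m ≤ q ≤ M`
  have hfin : {x : Literature.Probability.LatticeModels.Site 3 | ¬(m ≤ q x ∧ q x ≤ M)}.Finite :=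
    Filter.eventually_cofinite.1 hbd
  obtain ⟨B₀, hB₀⟩ := (hfin.image q).bddAbove
  obtain ⟨b₀, hb₀⟩ := (hfin.image q).bddBelow
  have hqB : ∀ x, q x ≤ max M B₀ := fun x => by
    by_cases hx : m ≤ q x ∧ q x ≤ M
    · exact hx.2.trans (le_max_left _ _)
    · exact (hB₀ ⟨x, hx, rfl⟩).trans (le_max_right _ _)
  have hqb : ∀ x, min m b₀ ≤ q x := fun x => by
    by_cases hx : m ≤ q x ∧ q x ≤ M
    · exact (min_le_left _ _).trans hx.1
    · exact (min_le_right _ _).trans (hb₀ ⟨x, hx, rfl⟩)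
  obtain ⟨Sb₀, hSb₀⟩ := (hfin.image fun x => ∑ i, ((x i : ℤ) : ℝ) ^ 2).bddAbove
  have hSb : ∀ x : Literature.Probability.LatticeModels.Site 3, Sb₀ + 1 ≤ ∑ i, ((x i : ℤ) : ℝ) ^ 2 →
      m ≤ q x ∧ q x ≤ M := fun x hx => by
    by_contra hcon
    have h' : ∑ i, ((x i : ℤ) : ℝ) ^ 2 ≤ Sb₀ := hSb₀ ⟨x, hcon, rfl⟩
    linarith only [h', hx]
  -- exterior suprema and infima
  obtain ⟨Qsup, hQsup⟩ : ∃ Qsup : ℝ → ℝ, ∀ S, Qsup S =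
      sSup (q '' {y : Literature.Probability.LatticeModels.Site 3 | S ≤ ∑ i, ((y i : ℤ) : ℝ) ^ 2}) :=
    ⟨_, fun _ => rfl⟩
  obtain ⟨Qinf, hQinf⟩ : ∃ Qinf : ℝ → ℝ, ∀ S, Qinf S =
      sInf (q '' {y : Literature.Probability.LatticeModels.Site 3 | S ≤ ∑ i, ((y i : ℤ) : ℝ) ^ 2}) :=
    ⟨_, fun _ => rfl⟩
  have hQsup_ge : ∀ (S : ℝ) (x : Literature.Probability.LatticeModels.Site 3),
      S ≤ ∑ i, ((x i : ℤ) : ℝ) ^ 2 → q x ≤ Qsup S := fun S x hx => by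
    rw [hQsup]; exact le_csSup_exterior hqB hx
  have hQsup_le : ∀ (S K : ℝ), (∀ x : Literature.Probability.LatticeModels.Site 3,
      S ≤ ∑ i, ((x i : ℤ) : ℝ) ^ 2 → q x ≤ K) → Qsup S ≤ K := fun S K hK => by
    rw [hQsup]; exact csSup_exterior_le hK
  have hQinf_le : ∀ (S : ℝ) (x : Literature.Probability.LatticeModels.Site 3),
      S ≤ ∑ i, ((x i : ℤ) : ℝ) ^ 2 → Qinf S ≤ q x := fun S x hx => by
    rw [hQinf]; exact csInf_exterior_le hqb hx
  have hQinf_ge : ∀ (S K : ℝ), (∀ x : Literature.Probability.LatticeModels.Site 3,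
      S ≤ ∑ i, ((x i : ℤ) : ℝ) ^ 2 → K ≤ q x) → K ≤ Qinf S := fun S K hK => by
    rw [hQinf]; exact le_csInf_exterior hK
  have hQinf_le_Qsup : ∀ S, Qinf S ≤ Qsup S := fun S => by
    obtain ⟨x₀, hx₀⟩ := exists_sumSq_ge S
    exact (hQinf_le S x₀ hx₀).trans (hQsup_ge S x₀ hx₀)
  have hQsup_fun : Qsup = fun S => sSup (q '' {y : Literature.Probability.LatticeModels.Site 3 |
      S ≤ ∑ i, ((y i : ℤ) : ℝ) ^ 2}) := funext hQsup
  have hQinf_fun : Qinf = fun S => sInf (q '' {y : Literature.Probability.LatticeModels.Site 3 |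
      S ≤ ∑ i, ((y i : ℤ) : ℝ) ^ 2}) := funext hQinf
  have hQsup_t : Tendsto Qsup atTop (𝓝 (⨅ S : ℝ, Qsup S)) := by
    rw [hQsup_fun]; exact tendsto_csSup_exterior hqb hqB
  have hQinf_t : Tendsto Qinf atTop (𝓝 (⨆ S : ℝ, Qinf S)) := by
    rw [hQinf_fun]; exact tendsto_csInf_exterior hqb hqB
  set Lp : ℝ := ⨅ S : ℝ, Qsup S with hLp
  set Lm : ℝ := ⨆ S : ℝ, Qinf S with hLm
  ------------------------------------------------------------------
  -- the key inequality at every large scale `S'` (Harnack chain)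
  ------------------------------------------------------------------
  set Sstar : ℝ := max (max (max S₀ 0) (100 * max S₁ (Sb₀ + 1)))
    (max (max ((max r₀ 0) ^ 2) (128 ^ 2)) ((10 * max R 0) ^ 2)) with hSstar
  have key : ∀ S' : ℝ, Sstar ≤ S' →
      (1 - η₁ S') * (Qsup (S' / 100) - Cst ^ N * ((Qsup (S' / 100) - Qsup S' / (1 + η₁ S')) +
        3 * N * η₃ (S' / 100) * Qsup (S' / 100))) ≤ Qinf S' := by
    intro S' hS'
    -- thresholds
    have hS'S₀ : S₀ ≤ S' := le_trans (by simp [hSstar]) hS'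
    have hS'S₁ : S₁ ≤ S' / 100 := by
      have h1 : 100 * max S₁ (Sb₀ + 1) ≤ S' := le_trans (by simp [hSstar]) hS'
      have h2 := le_max_left S₁ (Sb₀ + 1)
      linarith only [h1, h2]
    have hS'r₀ : (max r₀ 0) ^ 2 ≤ S' := le_trans (by simp [hSstar]) hS'
    have hS'128 : (128 : ℝ) ^ 2 ≤ S' := le_trans (by simp [hSstar]) hS'
    have hS'R : (10 * max R 0) ^ 2 ≤ S' := le_trans (by simp [hSstar]) hS'
    have hS'0 : 0 ≤ S' := le_trans (by positivity) hS'128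
    set r : ℝ := Real.sqrt S' with hr
    have hrS : r ^ 2 = S' := Real.sq_sqrt hS'0
    have hr128 : 128 ≤ r := by rw [hr, Real.le_sqrt (by norm_num) hS'0]; exact hS'128
    have hr0 : 0 < r := by linarith only [hr128]
    have hr64 : 64 ≤ r := by linarith only [hr128]
    have hrr₀ : r₀ ≤ r := by
      have : max r₀ 0 ≤ r := by rw [hr, Real.le_sqrt (le_max_right _ _) hS'0]; exact hS'r₀
      exact le_trans (le_max_left _ _) this
    have hrR : 10 * max R 0 ≤ r := by rw [hr, Real.le_sqrt (by positivity) hS'0]; exact hS'R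
    have hRr : R ≤ r / 10 := by
      have h1 := le_max_left R 0
      linarith only [h1, hrR]
    have hr2S : (r / 2) ^ 2 = S' / 4 := by rw [← hrS]; ring
    have hr10S : (r / 10) ^ 2 = S' / 100 := by rw [← hrS]; ring
    obtain ⟨hη₁0, hη₁h⟩ := hη₁b S' hS'S₀
    obtain ⟨hη₃0, hη₃h⟩ := hη₃b (S' / 100) hS'S₁
    -- norms versus levels
    have hlevel : ∀ x : Literature.Probability.LatticeModels.Site 3, r / 10 ≤ nrm x →
        S' / 100 ≤ ∑ i, ((x i : ℤ) : ℝ) ^ 2 := fun x hx => by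
      have h1 := (hnrm_le x (r / 10) (by positivity)).1 hx
      rw [hr10S] at h1
      exact h1
    -- the shell `{S'/4 ≤ s < S'}` and its extrema
    set Sh : Set (Literature.Probability.LatticeModels.Site 3) :=
      {y | S' / 4 ≤ ∑ i, ((y i : ℤ) : ℝ) ^ 2 ∧ ∑ i, ((y i : ℤ) : ℝ) ^ 2 < S'} with hSh
    have hShfin : Sh.Finite :=
      (EtaBoundsFromTelemetry.finite_sumSq_le S').subset fun y hy => le_of_lt hy.2
    have hShne : Sh.Nonempty := by
      obtain ⟨n, hn1, hn2⟩ : ∃ n : ℕ, r / 2 ≤ n ∧ (n : ℝ) < r / 2 + 1 :=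
        ⟨⌈r / 2⌉₊, Nat.le_ceil _, Nat.ceil_lt_add_one (by positivity)⟩
      refine ⟨Pi.single 0 (n : ℤ), ?_, ?_⟩
      · show S' / 4 ≤ ∑ i, (((Pi.single 0 (n : ℤ) : Literature.Probability.LatticeModels.Site 3) i : ℤ) : ℝ) ^ 2
        simp [Fin.sum_univ_three]
        nlinarith only [hn1, hrS, hr0]
      · show ∑ i, (((Pi.single 0 (n : ℤ) : Literature.Probability.LatticeModels.Site 3) i : ℤ) : ℝ) ^ 2 < S'
        simp [Fin.sum_univ_three]
        nlinarith only [hn1, hn2, hrS, hr128]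
    obtain ⟨x₁, hx₁Sh, hx₁⟩ := Set.exists_max_image Sh q hShfin hShne
    obtain ⟨x₂, hx₂Sh, hx₂⟩ := Set.exists_min_image Sh q hShfin hShne
    have hShnrm : ∀ y ∈ Sh, r / 2 ≤ nrm y ∧ nrm y ≤ r := fun y hy => by
      constructor
      · rw [hnrm_le y (r / 2) (by positivity), hr2S]; exact hy.1
      · rw [hnrm_ge y r hr0.le, hrS]; exact hy.2.le
    obtain ⟨hx₁lo, hx₁hi⟩ := hShnrm x₁ hx₁Sh
    obtain ⟨hx₂lo, hx₂hi⟩ := hShnrm x₂ hx₂Sh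
    have hr10 : r / 10 ≤ r / 2 := by linarith only [hr0]
    have hqx₁ : 0 < q x₁ := hqpos x₁ (hRr.trans (hr10.trans hx₁lo)) ((half_pos hr0).trans_le hx₁lo)
    have hqx₂ : 0 < q x₂ := hqpos x₂ (hRr.trans (hr10.trans hx₂lo)) ((half_pos hr0).trans_le hx₂lo)
    -- T1 at level `S'`
    obtain ⟨hT1u, hT1l⟩ := hT1' S' (q x₁) hS'S₀ hqx₁.le
    have hup : Qsup S' ≤ (1 + η₁ S') * q x₁ :=
      hQsup_le S' _ (hT1u fun y hy1 hy2 => hx₁ y ⟨hy1, hy2⟩)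
    obtain ⟨-, hT1l'⟩ := hT1' S' (q x₂) hS'S₀ hqx₂.le
    have hlow : (1 - η₁ S') * q x₂ ≤ Qinf S' :=
      hQinf_ge S' _ (hT1l' fun y hy1 hy2 => hx₂ y ⟨hy1, hy2⟩)
    clear hT1u hT1l hT1l'
    -- the ceiling `Q` of `q` on the fat region `{s ≥ S'/100}`
    set Q : ℝ := Qsup (S' / 100) with hQ
    have hqQ : ∀ x : Literature.Probability.LatticeModels.Site 3, r / 10 ≤ nrm x → q x ≤ Q :=
      fun x hx => hQsup_ge _ x (hlevel x hx)
    have hQx₁ : q x₁ ≤ Q := hqQ x₁ (hr10.trans hx₁lo)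
    have hQ0 : 0 ≤ Q := hqx₁.le.trans hQx₁
    -- the chain from `x₁` to `x₂`
    obtain ⟨z, hz0, hzN, hzin, hzstep⟩ := hT4' r hrr₀ x₁ x₂ hx₁lo hx₁hi hx₂lo hx₂hi
    -- propagation along the chain
    set η : ℝ := η₃ (S' / 100) with hηdef
    have hchain : Q - Cst ^ N * ((Q - q x₁) + 3 * N * η * Q) ≤ q (z N) := by
      refine chain_bound (a := fun j => q (z j)) hCst hη₃0 hQ0 (sub_nonneg.2 hQx₁) N
        (by show Q - (Q - q x₁) ≤ q (z 0); rw [hz0, sub_sub_cancel]) ?_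
      intro j hj ζ hζ hzj
      -- the comparison ball about `z j`
      obtain ⟨hzjlo, hzjhi⟩ := hzin j hj.le
      have hzjlo' : r / 4 ≤ Real.sqrt (∑ i, ((z j i : ℤ) : ℝ) ^ 2) := by rw [← hnrm]; exact hzjlo
      have hzjhi' : Real.sqrt (∑ i, ((z j i : ℤ) : ℝ) ^ 2) ≤ 2 * r := by rw [← hnrm]; exact hzjhi
      obtain ⟨hDfin, hDnorm, hDball, hDstep⟩ := ball_geometry r hr64 (z j) hzjlo' hzjhi'
      set D : Set (Literature.Probability.LatticeModels.Site 3) :=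
        {x | ∑ i, (((x i : ℤ) : ℝ) - ((z j i : ℤ) : ℝ)) ^ 2 ≤ (r / 8) ^ 2} with hD
      have hDnorm' : ∀ x ∈ D ∪ zdOuterBoundary D, r / 10 ≤ nrm x ∧ nrm x ≤ 3 * r := fun x hx => by
        rw [hnrm]; exact hDnorm x hx
      have hDfar : ∀ x ∈ D, S' / 100 ≤ ∑ i, ((x i : ℤ) : ℝ) ^ 2 := fun x hx =>
        hlevel x (hDnorm' x (Or.inl hx)).1
      -- the local harmonic comparison function
      obtain ⟨H, hHeq, hHoff, hHbd⟩ := hT3' (S' / 100) hS'S₁ D hDfin hDfar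
      have hnormU : ∀ x ∈ D ∪ zdOuterBoundary D, 0 < nrm x := fun x hx =>
        lt_of_lt_of_le (by positivity) (hDnorm' x hx).1
      have hHbdU : ∀ x ∈ D ∪ zdOuterBoundary D,
          (1 - η) * nrm x ^ (-α) ≤ H x ∧ H x ≤ (1 + η) * nrm x ^ (-α) := by
        intro x hx
        by_cases hxD : x ∈ D
        · exact hHbd x hxD
        · rw [hHoff x hxD]
          have hp : 0 ≤ nrm x ^ (-α) := Real.rpow_nonneg (hnrm_nn x) _
          constructor <;> nlinarith only [hp, hη₃0]
      have step := propagate u V H nrm α η Q ζ Cst (4 * (900 : ℝ) ^ α) (r ^ α * r ^ α) D (z j)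
        (z (j + 1)) ⌈3 * (r / 64)⌉₊ hHar hΛ hCst hη₃0 hη₃h hQ0 hζ
        (Nat.one_le_iff_ne_zero.2 (Nat.ceil_pos.2 (by positivity)).ne')
        hDball (hDstep _ (hzstep j hj))
        (fun x hx => hpos x (hRr.trans (hDnorm' x hx).1))
        (fun x hx => by
          rw [Literature.Probability.LatticeModels.latticeLaplacianZd_three]
          exact heq x (hRr.trans (hDnorm' x (Or.inl hx)).1))
        (fun x hx => by
          rw [Literature.Probability.LatticeModels.latticeLaplacianZd_three]
          exact hHeq x hx)
        hnormU (fun y hy => hHoff y hy.1) hHbd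
        (fun x hx y hy => conductance_bounds hr0 hα0 hη₃h (hDnorm' x hx).1 (hDnorm' x hx).2
          (hDnorm' y hy).1 (hDnorm' y hy).2 (hHbdU x hx) (hHbdU y hy))
        (fun x hx => by rw [← hq]; exact hqQ x (hDnorm' x hx).1)
        (by rw [← hq]; exact hzj)
      rw [← hq] at step
      exact step
    rw [hzN] at hchain
    -- combine
    have h1 : Qsup S' / (1 + η₁ S') ≤ q x₁ := by
      rw [div_le_iff₀ (by linarith only [hη₁0])]; linarith only [hup]
    have hCN : 0 ≤ Cst ^ N := pow_nonneg (by linarith only [hCst]) N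
    have h2 : Q - Cst ^ N * ((Q - Qsup S' / (1 + η₁ S')) + 3 * N * η * Q) ≤
        Q - Cst ^ N * ((Q - q x₁) + 3 * N * η * Q) := by
      have h4 := mul_le_mul_of_nonneg_left
        (show (Q - q x₁) ≤ Q - Qsup S' / (1 + η₁ S') by linarith only [h1]) hCN
      linarith only [h4]
    have h3 : (1 - η₁ S') * (Q - Cst ^ N * ((Q - Qsup S' / (1 + η₁ S')) + 3 * N * η * Q)) ≤
        (1 - η₁ S') * q x₂ :=
      mul_le_mul_of_nonneg_left (h2.trans hchain) (by linarith only [hη₁h])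
    exact h3.trans hlow
  ------------------------------------------------------------------
  -- limits: `Lp ≤ Lm`, hence `q → Lp`
  ------------------------------------------------------------------
  have hdiv : Tendsto (fun S : ℝ => S / 100) atTop atTop :=
    Filter.tendsto_id.atTop_div_const (by norm_num)
  have hQsup100 : Tendsto (fun S : ℝ => Qsup (S / 100)) atTop (𝓝 Lp) := hQsup_t.comp hdiv
  have hη₃100 : Tendsto (fun S : ℝ => η₃ (S / 100)) atTop (𝓝 0) := hη₃t.comp hdiv
  have hRHS : Tendsto (fun S' : ℝ => (1 - η₁ S') * (Qsup (S' / 100) - Cst ^ N *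
      ((Qsup (S' / 100) - Qsup S' / (1 + η₁ S')) + 3 * N * η₃ (S' / 100) * Qsup (S' / 100))))
      atTop (𝓝 ((1 - 0) * (Lp - Cst ^ N * ((Lp - Lp / (1 + 0)) + 3 * N * 0 * Lp)))) := by
    refine Tendsto.mul (tendsto_const_nhds.sub hη₁t) (Tendsto.sub hQsup100
      (Tendsto.mul tendsto_const_nhds (Tendsto.add (Tendsto.sub hQsup100
        (Tendsto.div hQsup_t (tendsto_const_nhds.add hη₁t) (by norm_num)))
        (Tendsto.mul (Tendsto.mul tendsto_const_nhds hη₃100) hQsup100))))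
  have hlim_eq : (1 - 0) * (Lp - Cst ^ N * ((Lp - Lp / (1 + 0)) + 3 * N * 0 * Lp)) = Lp := by ring
  rw [hlim_eq] at hRHS
  have hLpLm : Lp ≤ Lm :=
    le_of_tendsto_of_tendsto hRHS hQinf_t (Filter.eventually_atTop.2 ⟨Sstar, key⟩)
  have hLmLp : Lm ≤ Lp :=
    le_of_tendsto_of_tendsto hQinf_t hQsup_t (Filter.Eventually.of_forall hQinf_le_Qsup)
  have hLe : Lm = Lp := le_antisymm hLmLp hLpLm
  ------------------------------------------------------------------
  -- conclusion
  ------------------------------------------------------------------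
  refine ⟨Lp, ?_, ?_, ?_⟩
  · refine ge_of_tendsto hQsup_t (Filter.eventually_atTop.2 ⟨Sb₀ + 1, fun S hS => ?_⟩)
    obtain ⟨x₀, hx₀⟩ := exists_sumSq_ge S
    exact ((hSb x₀ (hS.trans hx₀)).1).trans (hQsup_ge S x₀ hx₀)
  · refine le_of_tendsto hQsup_t (Filter.eventually_atTop.2 ⟨Sb₀ + 1, fun S hS => ?_⟩)
    exact hQsup_le S M fun x hx => (hSb x (hS.trans hx)).2
  · intro δ hδ ρ₀
    have e1 : ∀ᶠ S in atTop, Qsup S < Lp + δ :=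
      hQsup_t.eventually (eventually_lt_nhds (by linarith only [hδ]))
    have e2 : ∀ᶠ S in atTop, Lm - δ < Qinf S :=
      hQinf_t.eventually (eventually_gt_nhds (by linarith only [hδ]))
    obtain ⟨T, hT⟩ := Filter.eventually_atTop.1 (e1.and e2)
    refine ⟨max ρ₀ (Real.sqrt (max T 0)), le_max_left _ _, fun x hx1 _ => ?_⟩
    have hxT : T ≤ ∑ i, ((x i : ℤ) : ℝ) ^ 2 := by
      have h1 : Real.sqrt (max T 0) ≤ nrm x := le_trans (le_max_right _ _) hx1
      have h2 := (hnrm_le x _ (Real.sqrt_nonneg _)).1 h1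
      rw [Real.sq_sqrt (le_max_right _ _)] at h2
      exact le_trans (le_max_left _ _) h2
    obtain ⟨hT1'', hT2''⟩ := hT T le_rfl
    have hq1 := hQsup_ge T x hxT
    have hq2 := hQinf_le T x hxT
    rw [hLe] at hT2''
    rw [abs_le]
    constructor <;> linarith only [hT1'', hT2'', hq1, hq2]


/-- **The lead's registered assembly stub `stub_blowDownOfHarnack` : T2 → S2.** The blow-down constant
(S2 `stub_blowDownConstant` of the skeleton) follows from the elliptic Harnack inequality for uniformly elliptic
conductances on `ℤ³` (T2, the named fact `Literature.Probability.LatticeModels.conductanceHarnackZ3`,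
Barlow 2017 Thm 7.19) alone, the other three inputs of `blowDown_assembly` being the landed stubs
`stub_shellMonotone` (T1), `stub_localComparison` (T3) and `stub_annulusChain` (T4). -/
theorem stub_blowDownOfHarnack :
    (∀ Λ : ℝ, 1 ≤ Λ → ∃ C : ℝ, 1 ≤ C ∧ ∀ (μ : Literature.Probability.LatticeModels.Site 3 → Literature.Probability.LatticeModels.Site 3 → ℝ) (h : Literature.Probability.LatticeModels.Site 3 → ℝ) (x₀ : Literature.Probability.LatticeModels.Site 3) (R : ℕ), 1 ≤ R → (∀ x : Literature.Probability.LatticeModels.Site 3, ∀ i : Fin 3, μ x (x + Pi.single i 1) = μ (x + Pi.single i 1) x) → (∀ x : Literature.Probability.LatticeModels.Site 3, ∀ i : Fin 3, Λ⁻¹ ≤ μ x (x + Pi.single i 1) ∧ μ x (x + Pi.single i 1) ≤ Λ) → (∀ x : Literature.Probability.LatticeModels.Site 3, 0 ≤ h x) → (∀ x : Literature.Probability.LatticeModels.Site 3, (∑ i, |x i - x₀ i|) ≤ 2 * (R : ℤ) → (∑ i : Fin 3, (μ x (x + Pi.single i 1) * (h (x + Pi.single i 1) - h x) + μ x (x -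 Pi.single i 1) * (h (x - Pi.single i 1) - h x))) = 0) → ∀ x y : Literature.Probability.LatticeModels.Site 3, (∑ i, |x i - x₀ i|) ≤ (R : ℤ) → (∑ i, |y i - x₀ i|) ≤ (R : ℤ) → h x ≤ C * h y) →
    ∀ κ ε C : ℝ, 0 ≤ κ → 0 < ε → ∀ (u V : Literature.Probability.LatticeModels.Site 3 → ℝ) (R : ℝ), (∀ x : Literature.Probability.LatticeModels.Site 3, R ≤ Real.sqrt (∑ i, ((x i : ℝ)) ^ 2) → 0 < u x) → (∀ x : Literature.Probability.LatticeModels.Site 3, R ≤ Real.sqrt (∑ i, ((x i : ℝ)) ^ 2) → (∑ i : Fin 3, (u (x + Pi.single i 1) + u (x - Pi.single i 1))) - 6 * u x = V x * u x) → (∀ x : Literature.Probability.LatticeModels.Site 3, R ≤ Real.sqrt (∑ i, ((x i : ℝ)) ^ 2) → |(∑ i, ((x i : ℝ)) ^ 2) * V x - κ| ≤ C * Real.sqrt (∑ i, ((x i : ℝ)) ^ 2) ^ (-ε)) → Filter.Tendsto u Filter.cofinite (nhds 0) → ∀ m M : ℝ, 0 < m → (∀ᶠ x : Literature.Probability.LatticeModels.Site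 3 in Filter.cofinite, m ≤ u x * Real.sqrt (∑ i, ((x i : ℝ)) ^ 2) ^ ((1 + Real.sqrt (1 + 4 * κ)) / 2) ∧ u x * Real.sqrt (∑ i, ((x i : ℝ)) ^ 2) ^ ((1 + Real.sqrt (1 + 4 * κ)) / 2) ≤ M) → ∃ c : ℝ, m ≤ c ∧ c ≤ M ∧ ∀ δ : ℝ, 0 < δ → ∀ ρ₀ : ℝ, ∃ ρ : ℝ, ρ₀ ≤ ρ ∧ ∀ x : Literature.Probability.LatticeModels.Site 3, ρ ≤ Real.sqrt (∑ i, ((x i : ℝ)) ^ 2) → Real.sqrt (∑ i, ((x i : ℝ)) ^ 2) ≤ 2 * ρ → |u x * Real.sqrt (∑ i, ((x i : ℝ)) ^ 2) ^ ((1 + Real.sqrt (1 + 4 * κ)) / 2) - c| ≤ δ :=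
  fun hT2 => blowDown_assembly stub_shellMonotone hT2 stub_localComparison stub_annulusChain

end Summit.CriticalPhenomena.Ising3DConformalLimit.Theorems.PositiveSolutionAsymptotics
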